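-- STATUS (stub_arp worker, seat c2, 2026-08-16T16:20Z): FINAL file, target Summits/.../Theorems/ParabolicTrajectoryContinuumLimitOnTrajectoryStubArp.lean,
-- proves the registered stub `theorem stub_arp : ARPOfRP` (axioms propext/Classical.choice/Quot.sound only, checked in scratch).
-- Expects tree imports: …StubArpB, …StubArpC, …StubArpT (this folder; land them first, in any order after StubArpA/DefsC are built),
-- Literature…OSVectorNormGrowth (built). Compiled in the concatenated scratch ScratchE.lean = A+B+DefsCExcerpt+C+T+this (rc 0,
-- 0 warnings, 0 sorries). Land with: ledger propose --kind proof --target …StubArp.lean --file work/stubs/StubArp.lean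
--   --supports stmt-QuantumFields-10522 --note "stub stub_arp for line two-orbit-synchronisation (seat c2)".
import Summits.QuantumFields.YangMills.Theorems.ParabolicTrajectoryContinuumLimitOnTrajectoryStubArpB
import Summits.QuantumFields.YangMills.Theorems.ParabolicTrajectoryContinuumLimitOnTrajectoryStubArpC
import Summits.QuantumFields.YangMills.Theorems.ParabolicTrajectoryContinuumLimitOnTrajectoryStubArpT
import Literature.MathematicalPhysics.QuantumFieldTheory.OSVectorNormGrowth

/-!
# Stub `stub_arp : ARPOfRP` (line `two-orbit-synchronisation`, crux stmt-QuantumFields-10522) — PROVED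

Final file of the stub worker for `stub_arp` (seat c2): approximate reflection positivity of the canonical curvature
distributions (`ARP`, DefsB) from slab reflection positivity on the scheme's tori (`TorusSlabRP`), the uniform-threshold
plaquette-string bounds (`UUVB`) and the E0'-type bounds (`UVB`). Assembly of `…StubArpA/B/C/T`:
* `integral_defect_mul_eq_sum`, `defect`, `sum_curvDistribution_appendTensor_eq` — at step `k`, for test functions supported at
  times of modulus `≤ T₀` (`T₀ + a_k ≤ a_k L_k`): `∑ᵢⱼ curvDistribution k (ΘF'ᵢ* ⊗ F'ⱼ) = ∫ conj(A∘Θ')·A dμ_k + defect`, the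
  defect being a finite sum of canonical PLAQUETTE-STRING distributions of `(F̃ᵢ − σ_{q⃗}F̃ᵢ) ⊗ F'ⱼ` (`σ_{q⃗}` = translation by
  `a_k e₀` in the electric slots: the time-chirality of the corner density);
* `norm_defect_le` — `‖defect‖ ≤ a_k · K` (`K` independent of `k`) from the `UUVB` inequality at `k`, the `O(a_k)` translation
  differences, the off-diagonality of the translated tensors and `|F ⊗ G|_M ≤ 2^{M+1}|F|_M|G|_M`;
* `stub_arp` — truncate (`exists_truncation`, cost `ε/3`), then eventually in `k`: OS pairing real `≥ 0` (`TorusSlabRP`; `A` lives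
  on lattice times `1 … w_k`, `2w_k ≤ L_k` since `a_k L_k → ∞`), `‖defect‖ ≤ a_k K ≤ ε/3`; hence `Re ≥ −ε`, `|Im| ≤ ε`.
-/

set_option autoImplicit false

open scoped SchwartzMap ComplexConjugate
open MeasureTheory Filter Topology
open Literature.MathematicalPhysics.QuantumFieldTheory Literature.MathematicalPhysics.QuantumLattice
open Literature.MathematicalPhysics.AQFT Literature.Probability.LatticeModels
open Summit.QuantumFields.YangMills.Theses.ParabolicTrajectory

noncomputable section

namespace Summit.QuantumFields.YangMills.Cruxes.ContinuumLimitOnTrajectory.TwoOrbitSynchronisation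

local notation "𝔼" => EuclideanSpace ℝ (Fin 4)

/-- (disambiguation: the gauge-configuration translation of `QuantumLattice`, not the spin one of `LatticeModels`) -/
local notation "cfgShift" => Literature.MathematicalPhysics.QuantumLattice.configShift

/-- (the time radius of a species, from the transfer files of crux (B); a notation to keep clear of the Literature
namesake) -/
local notation "tRadius" =>
  Summit.QuantumFields.YangMills.Cruxes.LatticeGapOnTrajectory.OrbitKantorovichFiniteSize.Transfer.timeRadius

namespace Arp

section PerK

variable {G : Type} [Group G] [TopologicalSpace G] [IsTopologicalGroup G] [CompactSpace G]
  [MeasurableSpace G] [BorelSpace G]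

/-! ## §1 The chirality defect at step `k` -/

/-- Products of lattice functionals of centred plaquette strings are integrable (bounded measurable functions on a
probability space). -/
theorem integrable_lat_Vq_mul (r : LatticeRep G) (sch : SpeciesScheme (YMSpecies G)) (k : ℕ) {n m : ℕ}
    (q : Fin n → PlaqIdx) (q' : Fin m → PlaqIdx) (A : 𝓢((Fin n → 𝔼), ℂ)) (B : 𝓢((Fin m → 𝔼), ℂ)) :
    Integrable (fun U => lat sch k (fun i => Vq r sch k (q i)) A U * lat sch k (fun j => Vq r sch k (q' j)) B U)
      (μW r sch k) := by
  have hmeas : ∀ {p : ℕ} (q : Fin p → PlaqIdx) (F : 𝓢((Fin p → 𝔼), ℂ)),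
      Measurable (lat sch k (fun i => Vq r sch k (q i)) F) := fun q F =>
    measurable_lat sch k (fun i => (plaq r (q i)).measurable.sub measurable_const) F
  have hbdd : ∀ {p : ℕ} (q : Fin p → PlaqIdx) (F : 𝓢((Fin p → 𝔼), ℂ)),
      ∃ C, ∀ U, ‖lat sch k (fun i => Vq r sch k (q i)) F U‖ ≤ C := fun q F =>
    exists_bound_lat sch k (fun i => by
      obtain ⟨C, hC⟩ := (plaq r (q i)).bounded
      exact ⟨C + |wilsonTorusMean r.ρ (sch.β k) (sch.L k) (plaq r (q i)).F|, fun V =>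
        (abs_sub _ _).trans (add_le_add (hC V) le_rfl)⟩) F
  obtain ⟨C₁, hC₁⟩ := hbdd q A
  obtain ⟨C₂, hC₂⟩ := hbdd q' B
  refine Integrable.of_bound ((hmeas q A).mul (hmeas q' B)).aestronglyMeasurable (C₁ * C₂)
    (Eventually.of_forall fun U => ?_)
  rw [norm_mul]
  exact mul_le_mul (hC₁ U) (hC₂ U) (norm_nonneg _) ((norm_nonneg _).trans (hC₁ U))

/-- **The defect identity.** For a test function `F̃` of degree `n` supported at times of modulus `≤ T`
(`T + a_k ≤ a_k L_k`) and any `F'` of degree `m`, the torus expectation of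
`(lat P̃ F̃ − lat (P̃∘Θ₀) F̃) · lat P̃ F'` (`P̃` the centred corner density) is the finite sum, over pairs of plaquette
strings, of the canonical plaquette-string distributions of `(F̃ − σ_{q⃗}F̃) ⊗ F'`. -/
theorem integral_defect_mul_eq_sum (r : LatticeRep G) (sch : SpeciesScheme (YMSpecies G)) (k : ℕ) {n m : ℕ}
    (Ft : 𝓢((Fin n → 𝔼), ℂ)) (F' : 𝓢((Fin m → 𝔼), ℂ)) {T : ℝ} (hF : ∀ x, Ft x ≠ 0 → ∀ i, |x i 0| ≤ T)
    (hT : T + sch.a k ≤ sch.a k * sch.L k) :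
    ∫ U, (lat sch k (fun _ => cen r sch k r.curvature.F) Ft U -
        lat sch k (fun _ V => cen r sch k r.curvature.F (cfgReflect V)) Ft U) *
        lat sch k (fun _ => cen r sch k r.curvature.F) F' U ∂(μW r sch k) =
      ∑ q : Fin n → PlaqIdx, ∑ q' : Fin m → PlaqIdx,
        canonDistribution r sch k (n + m) (fun i => plaq r (Fin.append q q' i))
          ((Ft - shiftTest sch k q Ft).appendTensor F') := by
  have hpt : ∀ U, (lat sch k (fun _ => cen r sch k r.curvature.F) Ft U -
      lat sch k (fun _ V => cen r sch k r.curvature.F (cfgReflect V)) Ft U) *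
      lat sch k (fun _ => cen r sch k r.curvature.F) F' U =
      ∑ q : Fin n → PlaqIdx, ∑ q' : Fin m → PlaqIdx,
        lat sch k (fun i => Vq r sch k (q i)) (Ft - shiftTest sch k q Ft) U *
          lat sch k (fun j => Vq r sch k (q' j)) F' U := by
    intro U
    rw [lat_curvature_expand, lat_curvature_cfgReflect_expand r sch k Ft hF hT, ← Finset.sum_sub_distrib,
      lat_curvature_expand r sch k F', Finset.sum_mul_sum]
    refine Finset.sum_congr rfl fun q _ => Finset.sum_congr rfl fun q' _ => ?_
    rw [lat_sub]
  simp_rw [hpt]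
  rw [integral_finsetSum _ fun q _ => integrable_finsetSum _ fun q' _ => integrable_lat_Vq_mul r sch k q q' _ _]
  refine Finset.sum_congr rfl fun q _ => ?_
  rw [integral_finsetSum _ fun q' _ => integrable_lat_Vq_mul r sch k q q' _ _]
  refine Finset.sum_congr rfl fun q' _ => ?_
  rw [canonDistribution_eq_integral_lat, ← append_Vq]
  refine integral_congr_ae (Eventually.of_forall fun U => ?_)
  exact (lat_append sch k _ _ (isAppendTensorOf_appendTensor _ _) U).symm

/-- **The chirality defect** of the Gram sum: canonical plaquette-string distributions of the tensors
`(F̃ᵢ − σ_{q⃗}F̃ᵢ) ⊗ F'ⱼ`, summed over `i, j` and the plaquette strings `q⃗, q⃗'`. -/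
def defect (r : LatticeRep G) (sch : SpeciesScheme (YMSpecies G)) (k : ℕ) {N : ℕ} (deg : Fin N → ℕ)
    (F' : (j : Fin N) → 𝓢((Fin (deg j) → 𝔼), ℂ)) : ℂ :=
  ∑ i, ∑ j, ∑ q : Fin (deg i) → PlaqIdx, ∑ q' : Fin (deg j) → PlaqIdx,
    canonDistribution r sch k (deg i + deg j) (fun l => plaq r (Fin.append q q' l))
      ((Ftil (F' i) - shiftTest sch k q (Ftil (F' i))).appendTensor (F' j))

/-- **The Gram sum at step `k`**: for test functions supported at times of modulus `≤ T₀` with `T₀ + a_k ≤ a_k L_k`,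
`∑ᵢⱼ curvDistribution k (ΘF'ᵢ* ⊗ F'ⱼ) = ∫ conj(A(Θ'U)) A(U) dμ_k + defect`. -/
theorem sum_curvDistribution_appendTensor_eq (r : LatticeRep G) (sch : SpeciesScheme (YMSpecies G)) (k : ℕ)
    {N : ℕ} (deg : Fin N → ℕ) (F' : (j : Fin N) → 𝓢((Fin (deg j) → 𝔼), ℂ)) {T₀ : ℝ}
    (hF' : ∀ j x, F' j x ≠ 0 → ∀ l, |x l 0| ≤ T₀) (hT : T₀ + sch.a k ≤ sch.a k * sch.L k) :
    ∑ i, ∑ j, curvDistribution r sch k (deg i + deg j) ((osAdjoint (F' i)).appendTensor (F' j)) =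
      (∫ U, conj (obsA r sch k deg F' U.negReflect) * obsA r sch k deg F' U ∂(μW r sch k)) +
        defect r sch k deg F' := by
  set cP := cen r sch k r.curvature.F with hcP
  -- the Gram sum as one integral
  have hterm : ∀ i j, curvDistribution r sch k (deg i + deg j) ((osAdjoint (F' i)).appendTensor (F' j)) =
      ∫ U, lat sch k (fun _ => cP) (Ftil (F' i)) U * lat sch k (fun _ => cP) (F' j) U ∂(μW r sch k) := by
    intro i j
    rw [curvDistribution_eq_integral_lat]
    refine integral_congr_ae (Eventually.of_forall fun U => ?_)
    dsimp only
    rw [← lat_osAdjoint_const, ← lat_append sch k (fun _ => cP) (fun _ => cP) (isAppendTensorOf_appendTensor _ _) U,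
      append_const]
  have hI : ∀ i j, Integrable (fun U => lat sch k (fun _ => cP) (Ftil (F' i)) U * lat sch k (fun _ => cP) (F' j) U)
      (μW r sch k) := fun i j => by
    have h := measurable_bdd_mul (measurable_bdd_latP r sch k (Ftil (F' i))) (measurable_bdd_latP r sch k (F' j))
    exact integrable_of_bdd r sch k h.1 h.2
  have hsum : ∑ i, ∑ j, curvDistribution r sch k (deg i + deg j) ((osAdjoint (F' i)).appendTensor (F' j)) =
      ∫ U, ∑ i, ∑ j, lat sch k (fun _ => cP) (Ftil (F' i)) U * lat sch k (fun _ => cP) (F' j) U ∂(μW r sch k) := by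
    rw [integral_finsetSum _ fun i _ => integrable_finsetSum _ fun j _ => hI i j]
    refine Finset.sum_congr rfl fun i _ => ?_
    rw [integral_finsetSum _ fun j _ => hI i j]
    exact Finset.sum_congr rfl fun j _ => hterm i j
  rw [hsum]
  -- split the integrand
  set B : GaugeConfig 4 (sch.side k) G → ℂ := fun U => ∑ i, lat sch k (fun _ => cP) (Ftil (F' i)) U with hB
  set A := obsA r sch k deg F' with hA
  have hBA : Measurable B ∧ ∃ C, ∀ U, ‖B U‖ ≤ C := measurable_bdd_sum fun i => measurable_bdd_latP r sch k _
  have hAA : Measurable A ∧ ∃ C, ∀ U, ‖A U‖ ≤ C := measurable_bdd_obsA r sch k deg F'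
  have hconjA : Measurable (fun U : GaugeConfig 4 (sch.side k) G => conj (A U.negReflect)) ∧
      ∃ C, ∀ U : GaugeConfig 4 (sch.side k) G, ‖conj (A U.negReflect)‖ ≤ C := by
    obtain ⟨hm, C, hC⟩ := hAA
    exact ⟨(Complex.continuous_conj.measurable.comp (hm.comp WilsonSiteRP.measurable_negReflect)),
      C, fun U => by rw [Complex.norm_conj]; exact hC _⟩
  have hsplit : ∀ U, ∑ i, ∑ j, lat sch k (fun _ => cP) (Ftil (F' i)) U * lat sch k (fun _ => cP) (F' j) U =
      conj (A U.negReflect) * A U + (B U - conj (A U.negReflect)) * A U := by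
    intro U
    have h : B U * A U = ∑ i, ∑ j, lat sch k (fun _ => cP) (Ftil (F' i)) U * lat sch k (fun _ => cP) (F' j) U := by
      simp only [hB, hA, obsA]
      exact Finset.sum_mul_sum _ _ _ _
    rw [← h]
    ring
  have hint1 : Integrable (fun U => conj (A U.negReflect) * A U) (μW r sch k) :=
    integrable_of_bdd r sch k (measurable_bdd_mul hconjA hAA).1 (measurable_bdd_mul hconjA hAA).2
  have hint2 : Integrable (fun U => (B U - conj (A U.negReflect)) * A U) (μW r sch k) :=
    integrable_of_bdd r sch k (measurable_bdd_mul (measurable_bdd_sub hBA hconjA) hAA).1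
      (measurable_bdd_mul (measurable_bdd_sub hBA hconjA) hAA).2
  have hsplitI : ∫ U, ∑ i, ∑ j, lat sch k (fun _ => cP) (Ftil (F' i)) U * lat sch k (fun _ => cP) (F' j) U
      ∂(μW r sch k) = (∫ U, conj (A U.negReflect) * A U ∂(μW r sch k)) +
        ∫ U, (B U - conj (A U.negReflect)) * A U ∂(μW r sch k) := by
    rw [← integral_add hint1 hint2]
    exact integral_congr_ae (Eventually.of_forall hsplit)
  rw [hsplitI]
  congr 1
  -- the defect
  have hdef : ∀ U, (B U - conj (A U.negReflect)) * A U = ∑ i, ∑ j,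
      (lat sch k (fun _ => cP) (Ftil (F' i)) U - lat sch k (fun _ V => cP (cfgReflect V)) (Ftil (F' i)) U) *
        lat sch k (fun _ => cP) (F' j) U := by
    intro U
    simp only [hB, hA, obsA, map_sum, lat_negReflect, conj_lat]
    rw [← Finset.sum_sub_distrib, Finset.sum_mul_sum]
  have hI2 : ∀ i j, Integrable (fun U =>
      (lat sch k (fun _ => cP) (Ftil (F' i)) U - lat sch k (fun _ V => cP (cfgReflect V)) (Ftil (F' i)) U) *
        lat sch k (fun _ => cP) (F' j) U) (μW r sch k) := fun i j => by
    have h := measurable_bdd_mul (measurable_bdd_sub (measurable_bdd_latP r sch k (Ftil (F' i)))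
      (measurable_bdd_latP_refl r sch k (Ftil (F' i)))) (measurable_bdd_latP r sch k (F' j))
    exact integrable_of_bdd r sch k h.1 h.2
  rw [integral_congr_ae (Eventually.of_forall hdef),
    integral_finsetSum _ fun i _ => integrable_finsetSum _ fun j _ => hI2 i j]
  unfold defect
  refine Finset.sum_congr rfl fun i _ => ?_
  rw [integral_finsetSum _ fun j _ => hI2 i j]
  refine Finset.sum_congr rfl fun j _ => ?_
  exact integral_defect_mul_eq_sum r sch k (Ftil (F' i)) (F' j) (Ftil_support_bound (hF' i)) hT

/-! ## §2 The defect is `O(a_k)` -/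

/-- **`‖defect‖ ≤ a_k · K`**, `K` independent of `k`: from the uniform plaquette-string bound at step `k` (the
`UUVB` inequality, `α ≥ 0`), separation of the supports (`a_k < δ`, all times in `[δ, T₀]`, gaps `≥ δ`) and
`a_k ≤ 1`. -/
theorem norm_defect_le (r : LatticeRep G) (sch : SpeciesScheme (YMSpecies G)) (k : ℕ) {s : ℕ} {α β : ℝ}
    (hα : 0 ≤ α)
    (hUk : ∀ (p : ℕ) (q : Fin p → PlaqIdx) (F : 𝓢((Fin p → 𝔼), ℂ)), IsOffDiagonal F →
      ‖canonDistribution r sch k p (fun i => plaq r (q i)) F‖ ≤ α * (p.factorial : ℝ) ^ β * schwartzNorm (p * s) F)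
    {N : ℕ} (deg : Fin N → ℕ) (F' : (j : Fin N) → 𝓢((Fin (deg j) → 𝔼), ℂ)) {δ : Fin N → ℝ} {T₀ : ℝ}
    (hsep : ∀ j, tsupport (F' j : (Fin (deg j) → 𝔼) → ℂ) ⊆
      {x | (∀ i, δ j ≤ x i 0 ∧ x i 0 ≤ T₀) ∧ ∀ i i', i < i' → x i 0 + δ j ≤ x i' 0})
    (hδ : ∀ j, 0 < δ j) (ha : ∀ j, sch.a k < δ j) (ha1 : sch.a k ≤ 1) :
    ‖defect r sch k deg F'‖ ≤ sch.a k *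
      ∑ i, ∑ j, ∑ _q : Fin (deg i) → PlaqIdx, ∑ _q' : Fin (deg j) → PlaqIdx,
        α * ((deg i + deg j).factorial : ℝ) ^ β * (2 ^ ((deg i + deg j) * s + 1) *
          (4 ^ ((deg i + deg j) * s) * schwartzNorm ((deg i + deg j) * s + 1) (Ftil (F' i))) *
            schwartzNorm ((deg i + deg j) * s) (F' j)) := by
  have ha0 : 0 ≤ sch.a k := (sch.a_pos k).le
  unfold defect
  rw [Finset.mul_sum]
  refine (norm_sum_le _ _).trans (Finset.sum_le_sum fun i _ => ?_)
  rw [Finset.mul_sum]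
  refine (norm_sum_le _ _).trans (Finset.sum_le_sum fun j _ => ?_)
  rw [Finset.mul_sum]
  refine (norm_sum_le _ _).trans (Finset.sum_le_sum fun q _ => ?_)
  rw [Finset.mul_sum]
  refine (norm_sum_le _ _).trans (Finset.sum_le_sum fun q' _ => ?_)
  set M := (deg i + deg j) * s with hM
  set D := Ftil (F' i) - shiftTest sch k q (Ftil (F' i)) with hD
  -- off-diagonality of the translated tensor
  have hoff : IsOffDiagonal (D.appendTensor (F' j)) := by
    refine isOffDiagonal_appendTensor_of_neg_of_pos (tsupport_Ftil_sub_shiftTest sch k (hsep i) (ha i) q)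
      ((hsep j).trans fun x hx => ⟨fun l => lt_of_lt_of_le (hδ j) (hx.1 l).1, fun l l' hll' => ?_⟩)
    by_contra hne
    rcases lt_or_gt_of_ne hne with hlt | hlt
    · have := hx.2 l l' hlt; linarith [hδ j, hll'.le, hll'.ge]
    · have := hx.2 l' l hlt; linarith [hδ j, hll'.le, hll'.ge]
  refine (hUk _ _ _ hoff).trans ?_
  -- Schwartz norms
  have h1 : schwartzNorm M (D.appendTensor (F' j)) ≤ 2 ^ (M + 1) * schwartzNorm M D * schwartzNorm M (F' j) :=
    schwartzNorm_appendTensor_le _ _ M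
  have h2 : schwartzNorm M D ≤ 4 ^ M * schwartzNorm (M + 1) (Ftil (F' i)) * sch.a k := by
    have hc : ‖shiftVec (elSlots q) (sch.a k)‖ ≤ 1 := (norm_shiftVec_le _ ha0).trans ha1
    have h := schwartzNorm_compSubConstCLM_sub_le M (Ftil (F' i)) hc
    rw [hD, ← neg_sub, show schwartzNorm M (-(shiftTest sch k q (Ftil (F' i)) - Ftil (F' i))) =
      schwartzNorm M (shiftTest sch k q (Ftil (F' i)) - Ftil (F' i)) from map_neg_eq_map _ _]
    exact h.trans (mul_le_mul_of_nonneg_left (norm_shiftVec_le _ ha0)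
      (mul_nonneg (pow_nonneg (by norm_num) _) (schwartzNorm_nonneg _ _)))
  have hF0 := schwartzNorm_nonneg M (F' j)
  have hT0 := schwartzNorm_nonneg (M + 1) (Ftil (F' i))
  have hfac : (0 : ℝ) ≤ α * ((deg i + deg j).factorial : ℝ) ^ β := by positivity
  calc α * ((deg i + deg j).factorial : ℝ) ^ β * schwartzNorm M (D.appendTensor (F' j))
      ≤ α * ((deg i + deg j).factorial : ℝ) ^ β *
          (2 ^ (M + 1) * (4 ^ M * schwartzNorm (M + 1) (Ftil (F' i)) * sch.a k) * schwartzNorm M (F' j)) := by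
        refine mul_le_mul_of_nonneg_left (h1.trans ?_) hfac
        gcongr
    _ = sch.a k * (α * ((deg i + deg j).factorial : ℝ) ^ β *
          (2 ^ (M + 1) * (4 ^ M * schwartzNorm (M + 1) (Ftil (F' i))) * schwartzNorm M (F' j))) := by ring

end PerK

end Arp

/-! ## The registered stub -/

/-- **Stub `stub_arp` (registered signature): approximate reflection positivity of the canonical curvature
distributions from slab reflection positivity, uniform plaquette-string bounds and E0'-type bounds.** -/
theorem stub_arp : ARPOfRP := by
  intro G _ _ _ _ _ _ r sch hRP hU hV N deg F hF H hH ε hε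
  have hε3 : 0 < ε / 3 := by positivity
  -- Step 1: `k`-independent truncation (`UVB`)
  obtain ⟨R, F', hR0, hsub, htrunc⟩ := Arp.exists_truncation r sch hV deg F hF H hH hε3
  -- Step 2: separation data of the compact supports
  have hsepEx : ∀ j, ∃ δ : ℝ, 0 < δ ∧ tsupport (F' j : (Fin (deg j) → 𝔼) → ℂ) ⊆
      {x | (∀ i, δ ≤ x i 0 ∧ x i 0 ≤ R) ∧ ∀ i i', i < i' → x i 0 + δ ≤ x i' 0} := fun j =>
    exists_timeSep_of_tsupport_subset (hF j) (hsub j)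
  choose δ hδ hsep using hsepEx
  have hF'supp : ∀ j x, F' j x ≠ 0 → ∀ l, δ j ≤ x l 0 ∧ x l 0 ≤ R := fun j x hx l =>
    (hsep j (subset_tsupport _ (Function.mem_support.2 hx))).1 l
  have hF'abs : ∀ j x, F' j x ≠ 0 → ∀ l, |x l 0| ≤ R := fun j x hx l => by
    have h := hF'supp j x hx l
    rw [abs_of_nonneg ((hδ j).le.trans h.1)]
    exact h.2
  -- Step 3: the uniform plaquette-string bound with a non-negative constant (`UUVB`)
  obtain ⟨s, α, β, hUU⟩ := hU
  have hUU' : ∀ᶠ k in atTop, ∀ (p : ℕ) (q : Fin p → PlaqIdx) (Fx : 𝓢((Fin p → 𝔼), ℂ)), IsOffDiagonal Fx →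
      ‖canonDistribution r sch k p (fun i => plaq r (q i)) Fx‖ ≤
        max α 0 * (p.factorial : ℝ) ^ β * schwartzNorm (p * s) Fx :=
    hUU.mono fun k hk p q Fx hFx => (hk p q Fx hFx).trans
      (mul_le_mul_of_nonneg_right (mul_le_mul_of_nonneg_right (le_max_left _ _) (by positivity))
        (schwartzNorm_nonneg _ _))
  -- Step 4: the slab-RP threshold and the eventualities
  obtain ⟨k₀, hk₀⟩ := hRP
  set Rc : ℕ := tRadius r.curvature with hRc
  obtain ⟨K, hK⟩ : ∃ K : ℝ, K = ∑ i, ∑ j, ∑ _q : Fin (deg i) → PlaqIdx, ∑ _q' : Fin (deg j) → PlaqIdx,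
      max α 0 * ((deg i + deg j).factorial : ℝ) ^ β * (2 ^ ((deg i + deg j) * s + 1) *
        (4 ^ ((deg i + deg j) * s) * schwartzNorm ((deg i + deg j) * s + 1) (Arp.Ftil (F' i))) *
          schwartzNorm ((deg i + deg j) * s) (F' j)) := ⟨_, rfl⟩
  have e3 : ∀ᶠ k in atTop, k₀ ≤ k := eventually_ge_atTop k₀
  have e4 : ∀ᶠ k in atTop, sch.a k ≤ 1 := (sch.tendsto_a.eventually (Iic_mem_nhds one_pos)).mono fun k hk => hk
  have e5 : ∀ᶠ k in atTop, ∀ j, sch.a k * ((Rc : ℝ) + 2) ≤ δ j := by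
    refine eventually_all.2 fun j => ?_
    have h : Tendsto (fun k => sch.a k * ((Rc : ℝ) + 2)) atTop (𝓝 (0 * ((Rc : ℝ) + 2))) :=
      sch.tendsto_a.mul_const _
    rw [zero_mul] at h
    exact (h.eventually (Iic_mem_nhds (hδ j))).mono fun k hk => hk
  have e6 : ∀ᶠ k in atTop, 2 * R + 2 * ((Rc : ℝ) + 2) ≤ sch.a k * sch.L k := sch.tendsto_L.eventually_ge_atTop _
  have e8 : ∀ᶠ k in atTop, sch.a k * K ≤ ε / 3 := by
    have h : Tendsto (fun k => sch.a k * K) atTop (𝓝 (0 * K)) := sch.tendsto_a.mul_const _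
    rw [zero_mul] at h
    exact (h.eventually (Iic_mem_nhds hε3)).mono fun k hk => hk
  filter_upwards [htrunc, hUU', e3, e4, e5, e6, e8] with k hk1 hk2 hk3 hk4 hk5 hk6 hk8
  -- Step 5: derived inequalities at step `k`
  have ha := sch.a_pos k
  have hRc0 : (0 : ℝ) ≤ Rc := Nat.cast_nonneg _
  have hT : R + sch.a k ≤ sch.a k * sch.L k := by linarith
  have haδ : ∀ j, sch.a k < δ j := fun j =>
    (lt_mul_of_one_lt_right ha (by linarith : (1 : ℝ) < (Rc : ℝ) + 2)).trans_le (hk5 j)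
  have hlo : ∀ j, sch.a k * ((Rc : ℝ) + 1) ≤ δ j := fun j =>
    (mul_le_mul_of_nonneg_left (by linarith : (Rc : ℝ) + 1 ≤ Rc + 2) ha.le).trans (hk5 j)
  set w : ℕ := ⌈R / sch.a k⌉₊ + Rc with hw
  have hw' : (w : ℝ) = ⌈R / sch.a k⌉₊ + Rc := by rw [hw]; push_cast; ring
  have hRa : sch.a k * (R / sch.a k) = R := by field_simp
  have hhi : R + sch.a k * (Rc : ℝ) ≤ sch.a k * (w : ℝ) := by
    have hc : R / sch.a k ≤ (⌈R / sch.a k⌉₊ : ℝ) := Nat.le_ceil _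
    have h1 := mul_le_mul_of_nonneg_left hc ha.le
    rw [hw']
    linarith
  have hw2 : 2 * w ≤ sch.L k := by
    have hceil : (⌈R / sch.a k⌉₊ : ℝ) < R / sch.a k + 1 := Nat.ceil_lt_add_one (div_nonneg hR0 ha.le)
    have h1 := mul_lt_mul_of_pos_left hceil ha
    have h2 : sch.a k * (Rc : ℝ) ≤ Rc := mul_le_of_le_one_left hRc0 hk4
    have h3 : sch.a k * (2 * (w : ℝ)) < sch.a k * (sch.L k : ℝ) := by rw [hw']; nlinarith
    have h4 : (2 * (w : ℝ)) < sch.L k := lt_of_mul_lt_mul_left h3 ha.le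
    have h5 : 2 * w < sch.L k := by exact_mod_cast h4
    exact h5.le
  -- Step 6: the identity and the three estimates at step `k`
  have hid := Arp.sum_curvDistribution_appendTensor_eq r sch k deg F' hF'abs hT
  have hP := Arp.osPairing_obsA_nonneg r sch k (hk₀ k hk3) deg F' hF'supp hlo hhi hw2
  have hD : ‖Arp.defect r sch k deg F'‖ ≤ ε / 3 := by
    refine (Arp.norm_defect_le r sch k (le_max_right α 0) hk2 deg F' hsep hδ haδ hk4).trans ?_
    rw [← hK]
    exact hk8
  -- Step 7: assembly
  set Z := ∑ i, ∑ j, curvDistribution r sch k (deg i + deg j) (H i j) with hZ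
  set Z' := ∑ i, ∑ j, curvDistribution r sch k (deg i + deg j) ((osAdjoint (F' i)).appendTensor (F' j)) with hZ'
  set P := ∫ U, conj (Arp.obsA r sch k deg F' U.negReflect) * Arp.obsA r sch k deg F' U ∂(μW r sch k) with hPdef
  set D := Arp.defect r sch k deg F' with hDdef
  have hZeq : Z = (Z - Z') + P + D := by rw [hid]; ring
  have h1 := abs_le.1 ((Complex.abs_re_le_norm (Z - Z')).trans hk1)
  have h2 := abs_le.1 ((Complex.abs_im_le_norm (Z - Z')).trans hk1)
  have h3 := abs_le.1 ((Complex.abs_re_le_norm D).trans hD)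
  have h4 := abs_le.1 ((Complex.abs_im_le_norm D).trans hD)
  refine ⟨?_, ?_⟩
  · rw [hZeq, Complex.add_re, Complex.add_re]
    linarith [hP.1, h1.1, h3.1]
  · rw [hZeq, Complex.add_im, Complex.add_im, hP.2]
    refine abs_le.2 ⟨?_, ?_⟩ <;> linarith [h2.1, h2.2, h4.1, h4.2]

end Summit.QuantumFields.YangMills.Cruxes.ContinuumLimitOnTrajectory.TwoOrbitSynchronisation

end
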